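import Literature.NumberTheory.Automorphic.GraphGroupCompat
import Literature.NumberTheory.Automorphic.SubtorusLie
import Literature.NumberTheory.Automorphic.IdentityComponent
import HarnessLib

/-!
# The graph torus is a maximal torus of the graph group
(trunk T-AUTOMORPHIC, G25 AutomorphicL; group-level step of the graph proof of
`chevalley_isomorphism_abstract` / `chevalley_isomorphism`, Springer 9.6.2)

Continuation of `GraphGroupCompat.lean`; notation as there (`H = graphGroup … Δ`, `T̃ = graphTorus`,
`D = graphSubalgebra`, `Δ = simpleRoots P y`). We prove that **`T̃` is a maximal torus of `H`**
(`isMaximalTorusIn_graphTorus`). Outline: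

* `H = T̃ · H₁` with `H₁ = graphUnip` the subgroup generated by the diagonal root homomorphisms
  (`exists_graphTorus_mul_of_mem`; `T̃` normalises `H₁`), so `T_H = H ∩ (T₁ × T₂) ≤ T̃ ⊔ T_{H,1}` with
  `T_{H,1} = H₁ ∩ (T₁ × T₂)` (`torusPart_le_sup`);
* **the Lie algebra of a torus `S ≤ T_{H,1}` lies in `Lie(T̃)`** (`lieAlgebraGL_le_of_torus_le`):
  for `X = diag(A, B) ∈ Lie(S)`, `[X, D̃] ⊆ D̃` (`H` stabilises `D`, `lie_mem_of_forall_conj_mem`) gives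
  `dα(B) = dα(θ A)` on the simple roots, hence `B - θA ∈ 𝔷₂` (`sub_theta_mem_torusCenter`); the
  determinants `det (·|_W)` on stable subspaces are `1` on the unipotently generated `H₁`, so
  `tr (A|_{W₁}) = 0 = tr (B|_{W₂})` (`StableSubspaceDet.lean`, through the block Lie-algebra lemma
  `toBlocks₁₁_mem_lieAlgebraGL_fstOf`), whence `A ∈ ∑ k h¹_j` and `B = θA` (`TorusCenterSpan.lean`),
  i.e. `X ∈ ∑ k h̃_j ⊆ Lie(T̃)`;
* hence `(T_{H,1})° ≤ T̃` (`SubtorusLie.le_of_lieAlgebraGL_le` inside the torus `T₁ × T₂`), `T̃` has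
  finite index in `T_H` (`relIndex_graphTorus_torusPart_ne_zero`), every torus of `H` containing `T̃`
  lies in `T_H` (its blocks centralise `T₁`, `T₂`: Springer 7.6.4 (ii)) and so equals `T̃` by
  connectedness.

Everything is proved; no named fact is introduced.

## Mathlib / Literature

Searched `prodBlock` + `torus`, `identityComponent`, `relIndex`, `fstOf`, `restrMat`: the torus
`T₁ × T₂` is assembled from `BlockDiagonalGL.lean` (`prodBlock`, `isAlgebraicGL_inlBlock/inrBlock`,
`isSemisimpleElt_blockDiagGL_of_mem`) and `ZariskiGLGeneration.isZConnected_sup`; identity components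
and their finite index are `IdentityComponent.lean`; the index bookkeeping is Mathlib's
`Subgroup.relIndex` (`relIndex_sup_left`, `relIndex_subgroupOf`, `relIndex_eq_zero_of_le_left/right`);
`fstOf`/`sndOf` generalise `fstOfGraphGroup` of `IsomorphismGraphGroup.lean` to arbitrary subgroups of
block-diagonal matrices (needed for subgroups of `H`). Nothing here duplicates a Mathlib or Literature
declaration.

## References

* [SpringerLAG1998] T. A. Springer, *Linear Algebraic Groups*, 2nd ed. (1998), 9.6.2, 7.6.4, 2.2.1.
-/

noncomputable section

open scoped MatrixGroups IsMulCommutative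
open Set

attribute [local instance 100] LieRing.ofAssociativeRing

namespace Literature.NumberTheory.Automorphic

namespace LieGraph

variable {k : Type*} [Field k]
variable {n₁ n₂ : Type*} [Fintype n₁] [DecidableEq n₁] [Fintype n₂] [DecidableEq n₂]
variable {ι X Y : Type*} [AddCommGroup X] [AddCommGroup Y]
variable {G₁ T₁ : Subgroup (GL n₁ k)} {G₂ T₂ : Subgroup (GL n₂ k)}
  [IsMulCommutative ↥T₁] [IsMulCommutative ↥T₂]
variable {P : RootPairing ι ℤ X Y}
variable {eX₁ : Additive ↥(characterLattice T₁) ≃+ X} {eY₁ : Additive ↥(cocharacterLattice T₁) ≃+ Y}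
variable {eX₂ : Additive ↥(characterLattice T₂) ≃+ X} {eY₂ : Additive ↥(cocharacterLattice T₂) ≃+ Y}

/-! ### Generalities: block Lie algebras and the torus `T₁ × T₂` -/

section General

omit [IsMulCommutative ↥T₁] [IsMulCommutative ↥T₂]

/-- The subgroup of first blocks of a subgroup of block-diagonal matrices. [folklore] -/
def fstOf (S : Subgroup (GL (n₁ ⊕ n₂) k)) (hS : S ≤ blockDiagRange n₁ n₂ k) : Subgroup (GL n₁ k) :=
  (fstBlockGL.comp (Subgroup.inclusion hS)).range

/-- The subgroup of second blocks. [folklore] -/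
def sndOf (S : Subgroup (GL (n₁ ⊕ n₂) k)) (hS : S ≤ blockDiagRange n₁ n₂ k) : Subgroup (GL n₂ k) :=
  (sndBlockGL.comp (Subgroup.inclusion hS)).range

/-- **The first block of an element of `Lie(S)` lies in `Lie(fstOf S)`** (restrict the `k[ε]`-point
blockwise, `tangentDeriv_aeval_fstCoordPoly`). [cite: SpringerLAG1998, 4.4.10 (3)] -/
theorem toBlocks₁₁_mem_lieAlgebraGL_fstOf {S : Subgroup (GL (n₁ ⊕ n₂) k)} (hS : S ≤ blockDiagRange n₁ n₂ k)
    {A : Matrix (n₁ ⊕ n₂) (n₁ ⊕ n₂) k} (hA : A ∈ lieAlgebraGL S) : A.toBlocks₁₁ ∈ lieAlgebraGL (fstOf S hS) := by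
  rw [mem_lieAlgebraGL_iff] at hA ⊢
  intro p hp
  rw [← tangentDeriv_aeval_fstCoordPoly]
  apply hA
  rw [MvPolynomial.mem_vanishingIdeal_iff] at hp ⊢
  rintro _ ⟨s, hs, rfl⟩
  rw [show (MvPolynomial.aeval (glCoordFun s)) (MvPolynomial.aeval (fstCoordPoly k n₁ n₂) p) =
      MvPolynomial.eval (glCoordFun s) (MvPolynomial.aeval (fstCoordPoly k n₁ n₂) p) from rfl]
  have hs' : s = ((⟨s, hS hs⟩ : ↥(blockDiagRange n₁ n₂ k)) : GL (n₁ ⊕ n₂) k) := rfl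
  rw [hs', ← blockDiagGL_fstBlockGL_sndBlockGL ⟨s, hS hs⟩, eval_aeval_fstCoordPoly]
  exact hp (glCoordFun (fstBlockGL ⟨s, hS hs⟩)) ⟨_, ⟨⟨s, hs⟩, rfl⟩, rfl⟩

/-- **The second block of an element of `Lie(S)` lies in `Lie(sndOf S)`.** [cite: SpringerLAG1998, 4.4.10 (3)] -/
theorem toBlocks₂₂_mem_lieAlgebraGL_sndOf {S : Subgroup (GL (n₁ ⊕ n₂) k)} (hS : S ≤ blockDiagRange n₁ n₂ k)
    {A : Matrix (n₁ ⊕ n₂) (n₁ ⊕ n₂) k} (hA : A ∈ lieAlgebraGL S) : A.toBlocks₂₂ ∈ lieAlgebraGL (sndOf S hS) := by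
  rw [mem_lieAlgebraGL_iff] at hA ⊢
  intro p hp
  rw [← tangentDeriv_aeval_sndCoordPoly]
  apply hA
  rw [MvPolynomial.mem_vanishingIdeal_iff] at hp ⊢
  rintro _ ⟨s, hs, rfl⟩
  rw [show (MvPolynomial.aeval (glCoordFun s)) (MvPolynomial.aeval (sndCoordPoly k n₁ n₂) p) =
      MvPolynomial.eval (glCoordFun s) (MvPolynomial.aeval (sndCoordPoly k n₁ n₂) p) from rfl]
  have hs' : s = ((⟨s, hS hs⟩ : ↥(blockDiagRange n₁ n₂ k)) : GL (n₁ ⊕ n₂) k) := rfl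
  rw [hs', ← blockDiagGL_fstBlockGL_sndBlockGL ⟨s, hS hs⟩, eval_aeval_sndCoordPoly]
  exact hp (glCoordFun (sndBlockGL ⟨s, hS hs⟩)) ⟨_, ⟨⟨s, hs⟩, rfl⟩, rfl⟩

/-- `T₁ × T₂` is generated by the two embedded copies. [folklore] -/
lemma prodBlock_eq_sup (T₁ : Subgroup (GL n₁ k)) (T₂ : Subgroup (GL n₂ k)) :
    prodBlock T₁ T₂ = ((inlBlock : GL n₁ k →* GL (n₁ ⊕ n₂) k).comp T₁.subtype).range ⊔
      ((inrBlock : GL n₂ k →* GL (n₁ ⊕ n₂) k).comp T₂.subtype).range := by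
  apply le_antisymm
  · intro g hg
    obtain ⟨a, ha, b, hb, rfl⟩ := mem_prodBlock_iff.1 hg
    rw [blockDiagGL_eq_inl_mul_inr]
    exact Subgroup.mul_mem _ (Subgroup.mem_sup_left ⟨⟨a, ha⟩, rfl⟩) (Subgroup.mem_sup_right ⟨⟨b, hb⟩, rfl⟩)
  · refine sup_le ?_ ?_
    · rintro _ ⟨a, rfl⟩
      rw [MonoidHom.comp_apply, Subgroup.coe_subtype, inlBlock_apply]
      exact blockDiagGL_mem_prodBlock a.2 T₂.one_mem
    · rintro _ ⟨b, rfl⟩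
      rw [MonoidHom.comp_apply, Subgroup.coe_subtype, inrBlock_apply]
      exact blockDiagGL_mem_prodBlock T₁.one_mem b.2

/-- **`T₁ × T₂` is a torus.** [cite: SpringerLAG1998, 3.2.7 and 2.2.7] -/
theorem isTorusSubgroup_prodBlock [IsAlgClosed k] (hT₁ : IsTorusSubgroup T₁) (hT₂ : IsTorusSubgroup T₂) :
    IsTorusSubgroup (prodBlock T₁ T₂) := by
  refine ⟨?_, ⟨⟨fun a b => ?_⟩⟩, fun t ht => ?_⟩
  · rw [prodBlock_eq_sup]
    exact isZConnected_sup ((isAlgebraicGL_inlBlock T₁).isZConnected_range hT₁.1)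
      ((isAlgebraicGL_inrBlock T₂).isZConnected_range hT₂.1)
  · obtain ⟨a₁, ha₁, a₂, ha₂, ha⟩ := mem_prodBlock_iff.1 a.2
    obtain ⟨b₁, hb₁, b₂, hb₂, hb⟩ := mem_prodBlock_iff.1 b.2
    apply Subtype.ext
    rw [Subgroup.coe_mul, Subgroup.coe_mul, ← ha, ← hb, ← map_mul, ← map_mul, Prod.mk_mul_mk, Prod.mk_mul_mk]
    congr 2
    · exact congrArg Subtype.val (hT₁.2.1.is_comm.comm ⟨a₁, ha₁⟩ ⟨b₁, hb₁⟩)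
    · exact congrArg Subtype.val (hT₂.2.1.is_comm.comm ⟨a₂, ha₂⟩ ⟨b₂, hb₂⟩)
  · obtain ⟨a, ha, b, hb, rfl⟩ := mem_prodBlock_iff.1 ht
    exact isSemisimpleElt_blockDiagGL_of_mem hT₁.2.1 hT₁.2.2 hT₂.2.1 hT₂.2.2 ha hb

/-- The linear embedding `(A, B) ↦ diag(A, B)` of `𝔤𝔩_{n₁} × 𝔤𝔩_{n₂}` into `𝔤𝔩_{n₁+n₂}`. [folklore] -/
def blockDiagLin : (Matrix n₁ n₁ k × Matrix n₂ n₂ k) →ₗ[k] Matrix (n₁ ⊕ n₂) (n₁ ⊕ n₂) k where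
  toFun d := Matrix.fromBlocks d.1 0 0 d.2
  map_add' d d' := by simp [Matrix.fromBlocks_add]
  map_smul' c d := by simp [Matrix.fromBlocks_smul]

omit [Fintype n₁] [DecidableEq n₁] [Fintype n₂] [DecidableEq n₂] in
/-- Unfolding of `blockDiagLin`. [folklore] -/
@[simp] lemma blockDiagLin_apply (d : Matrix n₁ n₁ k × Matrix n₂ n₂ k) :
    blockDiagLin d = Matrix.fromBlocks d.1 0 0 d.2 := rfl

omit [Fintype n₁] [DecidableEq n₁] [Fintype n₂] [DecidableEq n₂] in
/-- `blockDiagLin` is injective. [folklore] -/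
lemma blockDiagLin_injective : Function.Injective (blockDiagLin : (Matrix n₁ n₁ k × Matrix n₂ n₂ k) →ₗ[k] _) := by
  intro d d' h
  simp only [blockDiagLin_apply] at h
  have h1 := congrArg Matrix.toBlocks₁₁ h
  have h2 := congrArg Matrix.toBlocks₂₂ h
  simp only [Matrix.toBlocks_fromBlocks₁₁, Matrix.toBlocks_fromBlocks₂₂] at h1 h2
  exact Prod.ext h1 h2

end General

/-! ### The unipotent part `H₁` and the decomposition `H = T̃ · H₁` -/

section Unip

variable [IsAlgClosed k] [CharZero k]
variable (hT₁ : IsMaximalTorusIn T₁ G₁) (hT₂ : IsMaximalTorusIn T₂ G₂)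
  (h₁ : IsRootDatumOf G₁ T₁ P eX₁ eY₁) (h₂ : IsRootDatumOf G₂ T₂ P eX₂ eY₂)

/-- **`H₁`**: the subgroup generated by the diagonal root homomorphisms `ũ_i`, `ṽ_i`, `i ∈ Δ`. [folklore] -/
def graphUnip (y : Y) : Subgroup (GL (n₁ ⊕ n₂) k) :=
  ⨆ i : ↥(simpleRoots P y), ((graphUpperGL h₁ h₂ i).range ⊔ (graphLowerGL h₁ h₂ i).range)

omit [CharZero k] in
/-- `H = T̃ ⊔ H₁`. [folklore] -/
lemma graphGroup_eq_sup (y : Y) :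
    graphGroup h₁ h₂ hT₁.2.1 hT₂.2.1 (simpleRoots P y) = graphTorus eX₁ eX₂ hT₁.2.1 hT₂.2.1 ⊔ graphUnip h₁ h₂ y := rfl

omit [CharZero k] in
/-- `H₁ ≤ H`. [folklore] -/
lemma graphUnip_le (y : Y) : graphUnip h₁ h₂ y ≤ graphGroup h₁ h₂ hT₁.2.1 hT₂.2.1 (simpleRoots P y) := le_sup_right

omit [CharZero k] in
include hT₁ hT₂ in
/-- `H₁` is Zariski-connected. [cite: SpringerLAG1998, 2.2.7 (i)] -/
theorem isZConnected_graphUnip (y : Y) : IsZConnected (graphUnip h₁ h₂ y) :=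
  isZConnected_iSup _ fun i => isZConnected_sup (isZConnected_range_graphUpperGL h₁ h₂ hT₁.2.1 hT₂.2.1 i)
    (isZConnected_range_graphLowerGL h₁ h₂ hT₁.2.1 hT₂.2.1 i)

omit [CharZero k] in
/-- **`T̃` normalises `H₁`.** [cite: SpringerLAG1998, 8.1.1 (i)] -/
theorem conj_mem_graphUnip {y : Y} {τ : GL (n₁ ⊕ n₂) k} (hτ : τ ∈ graphTorus eX₁ eX₂ hT₁.2.1 hT₂.2.1)
    {η : GL (n₁ ⊕ n₂) k} (hη : η ∈ graphUnip h₁ h₂ y) : τ * η * τ⁻¹ ∈ graphUnip h₁ h₂ y := by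
  obtain ⟨t, rfl⟩ := hτ
  suffices hle : graphUnip h₁ h₂ y ≤ (graphUnip h₁ h₂ y).comap
      ((MulAut.conj (graphTorusHom eX₁ eX₂ hT₁.2.1 hT₂.2.1 t)).toMonoidHom) from hle hη
  refine iSup_le fun i => sup_le ?_ ?_
  · rintro _ ⟨x, rfl⟩
    rw [Subgroup.mem_comap, MulEquiv.coe_toMonoidHom, MulAut.conj_apply,
      show x = Multiplicative.ofAdd x.toAdd from rfl, graphTorusHom_conj_graphUpperGL]
    exact Subgroup.mem_iSup_of_mem i (Subgroup.mem_sup_left ⟨_, rfl⟩)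
  · rintro _ ⟨x, rfl⟩
    rw [Subgroup.mem_comap, MulEquiv.coe_toMonoidHom, MulAut.conj_apply,
      show x = Multiplicative.ofAdd x.toAdd from rfl, graphTorusHom_conj_graphLowerGL]
    exact Subgroup.mem_iSup_of_mem i (Subgroup.mem_sup_right ⟨_, rfl⟩)

omit [CharZero k] in
/-- **`H = T̃ · H₁`**: every element of the graph group is a product `τ η`, `τ ∈ T̃`, `η ∈ H₁`.
[cite: SpringerLAG1998, 9.6.2] -/
theorem exists_graphTorus_mul_of_mem {y : Y} {g : GL (n₁ ⊕ n₂) k}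
    (hg : g ∈ graphGroup h₁ h₂ hT₁.2.1 hT₂.2.1 (simpleRoots P y)) :
    ∃ τ ∈ graphTorus eX₁ eX₂ hT₁.2.1 hT₂.2.1, ∃ η ∈ graphUnip h₁ h₂ y, g = τ * η := by
  -- the set of such products is a subgroup containing `T̃` and `H₁`
  let M : Subgroup (GL (n₁ ⊕ n₂) k) :=
    { carrier := {g | ∃ τ ∈ graphTorus eX₁ eX₂ hT₁.2.1 hT₂.2.1, ∃ η ∈ graphUnip h₁ h₂ y, g = τ * η}
      one_mem' := ⟨1, Subgroup.one_mem _, 1, Subgroup.one_mem _, by rw [one_mul]⟩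
      mul_mem' := by
        rintro _ _ ⟨τ, hτ, η, hη, rfl⟩ ⟨τ', hτ', η', hη', rfl⟩
        refine ⟨τ * τ', Subgroup.mul_mem _ hτ hτ', τ'⁻¹ * η * τ'⁻¹⁻¹ * η',
          Subgroup.mul_mem _ (conj_mem_graphUnip hT₁ hT₂ h₁ h₂ (Subgroup.inv_mem _ hτ') hη) hη', ?_⟩
        rw [inv_inv]; group
      inv_mem' := by
        rintro _ ⟨τ, hτ, η, hη, rfl⟩
        refine ⟨τ⁻¹, Subgroup.inv_mem _ hτ, τ * η⁻¹ * τ⁻¹,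
          conj_mem_graphUnip hT₁ hT₂ h₁ h₂ hτ (Subgroup.inv_mem _ hη), ?_⟩
        group }
  have hle : graphGroup h₁ h₂ hT₁.2.1 hT₂.2.1 (simpleRoots P y) ≤ M := by
    rw [graphGroup_eq_sup hT₁ hT₂ h₁ h₂ y]
    refine sup_le (fun τ hτ => ⟨τ, hτ, 1, Subgroup.one_mem _, by rw [mul_one]⟩)
      (fun η hη => ⟨1, Subgroup.one_mem _, η, hη, by rw [one_mul]⟩)
  exact hle hg

/-- **`T_H = H ∩ (T₁ × T₂)`.** [folklore] -/
def torusPart (y : Y) : Subgroup (GL (n₁ ⊕ n₂) k) :=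
  graphGroup h₁ h₂ hT₁.2.1 hT₂.2.1 (simpleRoots P y) ⊓ prodBlock T₁ T₂

/-- **`T_{H,1} = H₁ ∩ (T₁ × T₂)`.** [folklore] -/
def torusPart₁ (y : Y) : Subgroup (GL (n₁ ⊕ n₂) k) := graphUnip h₁ h₂ y ⊓ prodBlock T₁ T₂

omit [CharZero k] in
/-- `T̃ ≤ T_H`. [folklore] -/
lemma graphTorus_le_torusPart (y : Y) : graphTorus eX₁ eX₂ hT₁.2.1 hT₂.2.1 ≤ torusPart hT₁ hT₂ h₁ h₂ y :=
  le_inf (graphTorus_le_graphGroup h₁ h₂ hT₁.2.1 hT₂.2.1 _) (graphTorus_le_prodBlock eX₁ eX₂ hT₁.2.1 hT₂.2.1)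

omit [CharZero k] in
/-- `T_{H,1} ≤ T_H`. [folklore] -/
lemma torusPart₁_le (y : Y) : torusPart₁ h₁ h₂ y ≤ torusPart hT₁ hT₂ h₁ h₂ y :=
  inf_le_inf_right _ (graphUnip_le hT₁ hT₂ h₁ h₂ y)

omit [CharZero k] in
/-- **`T_H ≤ T̃ ⊔ T_{H,1}`** (from `H = T̃ · H₁`). [cite: SpringerLAG1998, 9.6.2] -/
theorem torusPart_le_sup (y : Y) :
    torusPart hT₁ hT₂ h₁ h₂ y ≤ graphTorus eX₁ eX₂ hT₁.2.1 hT₂.2.1 ⊔ torusPart₁ h₁ h₂ y := by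
  rintro g ⟨hg, hgT⟩
  obtain ⟨τ, hτ, η, hη, rfl⟩ := exists_graphTorus_mul_of_mem hT₁ hT₂ h₁ h₂ hg
  refine Subgroup.mul_mem _ (Subgroup.mem_sup_left hτ) (Subgroup.mem_sup_right ⟨hη, ?_⟩)
  have hτT := graphTorus_le_prodBlock eX₁ eX₂ hT₁.2.1 hT₂.2.1 hτ
  have := Subgroup.mul_mem _ (Subgroup.inv_mem _ hτT) hgT
  rwa [inv_mul_cancel_left] at this

omit [CharZero k] in
/-- `T_H` is algebraic. [folklore] -/
lemma isAlgebraicSubgroup_torusPart (y : Y) : IsAlgebraicSubgroup (torusPart hT₁ hT₂ h₁ h₂ y) :=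
  (isAlgebraicSubgroup_graphGroup h₁ h₂ hT₁.2.1 hT₂.2.1 _).inf (isAlgebraicSubgroup_prodBlock hT₁.2.1.1.1 hT₂.2.1.1.1)

omit [CharZero k] in
include hT₁ hT₂ in
/-- `T_{H,1}` is algebraic. [folklore] -/
lemma isAlgebraicSubgroup_torusPart₁ (y : Y) : IsAlgebraicSubgroup (torusPart₁ h₁ h₂ y) :=
  (isZConnected_graphUnip hT₁ hT₂ h₁ h₂ y).1.inf (isAlgebraicSubgroup_prodBlock hT₁.2.1.1.1 hT₂.2.1.1.1)

end Unip

/-! ### The Lie algebra of a torus inside `T_{H,1}` -/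

section TorusLie

variable [IsAlgClosed k] [CharZero k] [Fintype ι]
variable (hG₁ : IsConnectedReductive G₁) (hT₁ : IsMaximalTorusIn T₁ G₁)
  (hG₂ : IsConnectedReductive G₂) (hT₂ : IsMaximalTorusIn T₂ G₂)
  (h₁ : IsRootDatumOf G₁ T₁ P eX₁ eY₁) (h₂ : IsRootDatumOf G₂ T₂ P eX₂ eY₂)

include hG₁ hG₂ in
/-- **For `X = diag(A, B) ∈ Lie(T_H)`: `dα_i(B) = dα_i(A)` for the simple roots** — `T_H ≤ adStab`
stabilises `D̃ = diag(D)`, so `[X, (e¹_i, e²_i)] = (dα_i(A) e¹_i, dα_i(B) e²_i) ∈ D`, and `(0, e²_i) ∉ D`.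
[cite: SpringerLAG1998, 9.6.2] -/
theorem dChar_toBlocks_eq {y : Y} (hy : ∀ i, P.root' i y ≠ 0) {Xm : Matrix (n₁ ⊕ n₂) (n₁ ⊕ n₂) k}
    (hX : Xm ∈ lieAlgebraGL (torusPart hT₁ hT₂ h₁ h₂ y)) {i : ι} (hi : i ∈ simpleRoots P y) :
    dChar (Additive.toMul (eX₂.symm (P.root i))) Xm.toBlocks₂₂ =
      dChar (Additive.toMul (eX₁.symm (P.root i))) Xm.toBlocks₁₁ := by
  haveI : Infinite k := IsAlgClosed.instInfinite
  -- the blocks of `X`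
  have hXT := lieAlgebraGL_mono (inf_le_right : torusPart hT₁ hT₂ h₁ h₂ y ≤ prodBlock T₁ T₂) hX
  obtain ⟨hXeq, hA, hB⟩ := eq_fromBlocks_of_mem_lieAlgebraGL_prodBlock hXT
  set A := Xm.toBlocks₁₁
  set B := Xm.toBlocks₂₂
  -- `T_H` stabilises `D̃`
  set Dt : Submodule k (Matrix (n₁ ⊕ n₂) (n₁ ⊕ n₂) k) :=
    (graphSubalgebra hT₁ hT₂ h₁ h₂ y).toSubmodule.map blockDiagLin with hDt
  have hstab : ∀ g ∈ torusPart hT₁ hT₂ h₁ h₂ y, ∀ M ∈ Dt,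
      (g : Matrix (n₁ ⊕ n₂) (n₁ ⊕ n₂) k) * M * ((g⁻¹ : GL (n₁ ⊕ n₂) k) : Matrix (n₁ ⊕ n₂) (n₁ ⊕ n₂) k) ∈ Dt := by
    rintro g ⟨hgH, -⟩ _ ⟨d, hd, rfl⟩
    obtain ⟨g₁, g₂, -, -, rfl, hs⟩ := exists_of_mem_adStab hT₁ hT₂ h₁ h₂
      (graphGroup_le_adStab hG₁ hT₁ hG₂ hT₂ h₁ h₂ y hgH)
    refine ⟨adPair g₁ g₂ d, hs d hd, ?_⟩
    rw [blockDiagLin_apply, blockDiagLin_apply, blockDiagGL_conj_fromBlocks, adPair_apply]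
  -- `[X, ẽ_i] ∈ D̃`
  have hEt : blockDiagLin ((h₁.rootE i, h₂.rootE i) : Matrix n₁ n₁ k × Matrix n₂ n₂ k) ∈ Dt :=
    ⟨_, rootE_pair_mem hi, rfl⟩
  have hlie := lie_mem_of_forall_conj_mem hstab hX hEt
  rw [hXeq, blockDiagLin_apply, fromBlocks_commutator] at hlie
  obtain ⟨d, hd, hdeq⟩ := hlie
  have hd' : d = ((A * h₁.rootE i - h₁.rootE i * A, B * h₂.rootE i - h₂.rootE i * B) : Matrix n₁ n₁ k × Matrix n₂ n₂ k) :=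
    blockDiagLin_injective (by rw [hdeq]; rfl)
  rw [hd', lie_eq_dChar_smul _ (h₁.rootE_mem i).2 hA, lie_eq_dChar_smul _ (h₂.rootE_mem i).2 hB] at hd
  -- subtract `dα_i(A) · (e¹_i, e²_i)`
  have hsub := (graphSubalgebra hT₁ hT₂ h₁ h₂ y).sub_mem hd
    ((graphSubalgebra hT₁ hT₂ h₁ h₂ y).smul_mem (dChar (Additive.toMul (eX₁.symm (P.root i))) A) (rootE_pair_mem hi))
  rw [Prod.smul_mk, Prod.mk_sub_mk, sub_self, ← sub_smul] at hsub
  by_contra hne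
  have hc : dChar (Additive.toMul (eX₂.symm (P.root i))) B - dChar (Additive.toMul (eX₁.symm (P.root i))) A ≠ 0 :=
    sub_ne_zero.2 hne
  have := (graphSubalgebra hT₁ hT₂ h₁ h₂ y).smul_mem
    (dChar (Additive.toMul (eX₂.symm (P.root i))) B - dChar (Additive.toMul (eX₁.symm (P.root i))) A)⁻¹ hsub
  rw [Prod.smul_mk, smul_zero, smul_smul, inv_mul_cancel₀ hc, one_smul] at this
  exact not_inr_rootE_mem hG₁ hT₁ hG₂ hT₂ h₁ h₂ hy i this

include hG₁ hG₂ in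
/-- **`B - θA ∈ 𝔷₂` for `X = diag(A, B) ∈ Lie(T_H)`**: `dα(B - θA)` vanishes on the simple roots
(`dChar_toBlocks_eq`, `dχ_x (θ A) = dχ_x (A)`), hence on all roots. [cite: SpringerLAG1998, 9.6.2] -/
theorem sub_theta_mem_torusCenter {y : Y} (hy : ∀ i, P.root' i y ≠ 0) {Xm : Matrix (n₁ ⊕ n₂) (n₁ ⊕ n₂) k}
    (hX : Xm ∈ lieAlgebraGL (torusPart hT₁ hT₂ h₁ h₂ y)) (hA : Xm.toBlocks₁₁ ∈ lieAlgebraGL T₁)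
    (hB : Xm.toBlocks₂₂ ∈ lieAlgebraGL T₂) :
    Xm.toBlocks₂₂ - ((theta eX₁ eX₂ hT₁.2.1 hT₂.2.1 ⟨Xm.toBlocks₁₁, hA⟩ : ↥(lieAlgebraGL T₂)) : Matrix n₂ n₂ k) ∈
      torusCenter T₂ eX₂ P := by
  set ζ := Xm.toBlocks₂₂ - ((theta eX₁ eX₂ hT₁.2.1 hT₂.2.1 ⟨Xm.toBlocks₁₁, hA⟩ : ↥(lieAlgebraGL T₂)) : Matrix n₂ n₂ k)
  have hζ : ζ ∈ lieAlgebraGL T₂ := Submodule.sub_mem _ hB (theta eX₁ eX₂ hT₁.2.1 hT₂.2.1 ⟨_, hA⟩).2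
  -- the additive functional `x ↦ dχ_x(ζ)` vanishes on the simple roots
  let φ : X →+ k := (lieTorusDual T₂ ⟨ζ, hζ⟩).comp eX₂.symm.toAddMonoidHom
  have hφ : ∀ x, φ x = dChar (Additive.toMul (eX₂.symm x)) ζ := fun x => rfl
  have hsimple : ∀ i ∈ simpleRoots P y, φ (P.root i) = 0 := by
    intro i hi
    rw [hφ]
    change dChar _ (Xm.toBlocks₂₂ - _) = 0
    rw [map_sub, dChar_toBlocks_eq hG₁ hT₁ hG₂ hT₂ h₁ h₂ hy hX hi, dChar_theta eX₁ eX₂ hT₁.2.1 hT₂.2.1 ⟨_, hA⟩,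
      sub_self]
  -- hence on the positive roots, hence on all roots
  have hpos : ∀ l, 0 < P.root' l y → φ (P.root l) = 0 := by
    intro l hl
    have hmem := root_mem_closure_simpleRoots (P := P) hl
    refine AddSubmonoid.closure_induction (fun x hx => ?_) (map_zero φ) (fun x z _ _ hx hz => by
      rw [map_add, hx, hz, add_zero]) hmem
    obtain ⟨i, hi, rfl⟩ := hx
    exact hsimple i hi
  refine ⟨hζ, fun l => ?_⟩
  rw [← hφ]
  rcases lt_or_gt_of_ne (hy l) with hneg | hp
  · set l' := P.reflectionPerm l l with hl'def
    have hr : P.root l' = -P.root l := by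
      rw [hl'def, RootPairing.root_reflectionPerm, RootPairing.reflection_apply_self]
    have hl' : 0 < P.root' l' y := by
      have e : P.root' l' y = -(P.root' l y) := by
        rw [← coweightForm_root, ← coweightForm_root, hr, map_neg]
      rw [e]; linarith
    have h0 := hpos l' hl'
    rw [hr, map_neg, neg_eq_zero] at h0
    exact h0
  · exact hpos l hp

/-- The auxiliary subgroup of block-diagonal elements whose first block has `det (·|_{W₁}) = 1`. [folklore] -/
def detOneFst (W₁ : Submodule k (n₁ → k)) (hW₁ : ∀ g ∈ G₁, StableDet.Stab W₁ ((g : GL n₁ k) : Matrix n₁ n₁ k)) :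
    Subgroup (GL (n₁ ⊕ n₂) k) :=
  ((StableDet.detOneSubgroup W₁ G₁ hW₁).comap fstBlockGL).map (blockDiagRange n₁ n₂ k).subtype

/-- The auxiliary subgroup for the second block. [folklore] -/
def detOneSnd (W₂ : Submodule k (n₂ → k)) (hW₂ : ∀ g ∈ G₂, StableDet.Stab W₂ ((g : GL n₂ k) : Matrix n₂ n₂ k)) :
    Subgroup (GL (n₁ ⊕ n₂) k) :=
  ((StableDet.detOneSubgroup W₂ G₂ hW₂).comap sndBlockGL).map (blockDiagRange n₁ n₂ k).subtype

omit [CharZero k] [Fintype ι] [IsAlgClosed k] in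
/-- A block-diagonal element lies in `detOneFst` iff its first block has `det (·|_{W₁}) = 1` in `G₁`. [folklore] -/
lemma blockDiagGL_mem_detOneFst_iff {W₁ : Submodule k (n₁ → k)}
    {hW₁ : ∀ g ∈ G₁, StableDet.Stab W₁ ((g : GL n₁ k) : Matrix n₁ n₁ k)} {a : GL n₁ k} {b : GL n₂ k} :
    blockDiagGL (a, b) ∈ detOneFst (G₁ := G₁) (n₂ := n₂) W₁ hW₁ ↔ a ∈ StableDet.detOneSubgroup W₁ G₁ hW₁ := by
  constructor
  · rintro ⟨q, hq, hqe⟩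
    have hq' := Subgroup.mem_comap.1 hq
    have : q = ⟨blockDiagGL (a, b), blockDiagGL_mem_blockDiagRange _⟩ := Subtype.ext hqe
    rwa [this, fstBlockGL_mk] at hq'
  · intro ha
    exact ⟨⟨blockDiagGL (a, b), blockDiagGL_mem_blockDiagRange _⟩, Subgroup.mem_comap.2 (by rw [fstBlockGL_mk]; exact ha), rfl⟩

omit [CharZero k] [Fintype ι] [IsAlgClosed k] in
/-- The same for `detOneSnd`. [folklore] -/
lemma blockDiagGL_mem_detOneSnd_iff {W₂ : Submodule k (n₂ → k)}
    {hW₂ : ∀ g ∈ G₂, StableDet.Stab W₂ ((g : GL n₂ k) : Matrix n₂ n₂ k)} {a : GL n₁ k} {b : GL n₂ k} :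
    blockDiagGL (a, b) ∈ detOneSnd (G₂ := G₂) (n₁ := n₁) W₂ hW₂ ↔ b ∈ StableDet.detOneSubgroup W₂ G₂ hW₂ := by
  constructor
  · rintro ⟨q, hq, hqe⟩
    have hq' := Subgroup.mem_comap.1 hq
    have : q = ⟨blockDiagGL (a, b), blockDiagGL_mem_blockDiagRange _⟩ := Subtype.ext hqe
    rwa [this, sndBlockGL_mk] at hq'
  · intro hb
    exact ⟨⟨blockDiagGL (a, b), blockDiagGL_mem_blockDiagRange _⟩, Subgroup.mem_comap.2 (by rw [sndBlockGL_mk]; exact hb), rfl⟩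

omit [Fintype ι] [IsAlgClosed k] in
/-- `det (exp (x v)|_W) = 1` for a nilpotent `v ∈ Lie(G)` and a `G`-stable `W`. [cite: SpringerLAG1998, 2.4.2] -/
lemma det_restrMat_coe_expHom {m : Type*} [Fintype m] [DecidableEq m] {G : Subgroup (GL m k)}
    (W : Submodule k (m → k)) (hW : ∀ g ∈ G, StableDet.Stab W ((g : GL m k) : Matrix m m k))
    {v : Matrix m m k} (hv : v ∈ lieAlgebraGL G) (hn : IsNilpotent v) (x : Multiplicative k) :
    (StableDet.restrMat W ((expHom v hn x : GL m k) : Matrix m m k)).det = 1 := by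
  rw [coe_expHom_apply]
  refine StableDet.det_restrMat_exp W (hn.smul _) fun w hw => ?_
  rw [Matrix.smul_mulVec]
  exact Submodule.smul_mem _ _ (mulVec_mem_of_forall_mulVec_mem (fun g hg w hw => hW g hg w hw) hv hw)

omit [Fintype ι] in
include hG₁ hT₁ hT₂ in
/-- **`H₁ ≤ detOneFst`**: the first blocks of `H₁` have determinant `1` on every `G₁`-stable subspace.
[cite: SpringerLAG1998, 2.4.2 and 9.6.2] -/
theorem graphUnip_le_detOneFst (y : Y) (W₁ : Submodule k (n₁ → k))
    (hW₁ : ∀ g ∈ G₁, StableDet.Stab W₁ ((g : GL n₁ k) : Matrix n₁ n₁ k)) :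
    graphUnip h₁ h₂ y ≤ detOneFst (n₂ := n₂) W₁ hW₁ := by
  haveI : Infinite k := IsAlgClosed.instInfinite
  refine iSup_le fun i => sup_le ?_ ?_
  · rintro _ ⟨x, rfl⟩
    rw [graphUpperGL_apply, blockDiagGL_mem_detOneFst_iff, StableDet.mem_detOneSubgroup_iff]
    refine ⟨((h₁.rootSL2 i).comp unipotentUpperSL2 x).2, ?_⟩
    have hu := h₁.isRootHom_rootSL2_upper i
    have hnil : IsNilpotent hu.1.velocity := by
      rw [h₁.velocity_rootSL2_upper]; exact isNilpotent_of_fromBlocks₁ (isNilpotent_graphE h₁ h₂ hT₁.2.1 hT₂.2.1 i)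
    have e := hu.coe_apply_eq_exp hG₁.1.1 hnil x.toAdd
    rw [show Multiplicative.ofAdd x.toAdd = x from rfl] at e
    rw [e]
    refine det_restrMat_coe_expHom W₁ hW₁ ?_ hnil x
    rw [h₁.velocity_rootSL2_upper]; exact (h₁.rootE_mem i).1
  · rintro _ ⟨x, rfl⟩
    rw [graphLowerGL_apply, blockDiagGL_mem_detOneFst_iff, StableDet.mem_detOneSubgroup_iff]
    refine ⟨((h₁.rootSL2 i).comp unipotentLowerSL2 x).2, ?_⟩
    have hu := h₁.isRootHom_rootSL2_lower i
    have hnil : IsNilpotent hu.1.velocity := by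
      rw [h₁.velocity_rootSL2_lower]; exact isNilpotent_of_fromBlocks₁ (isNilpotent_graphF h₁ h₂ hT₁.2.1 hT₂.2.1 i)
    have e := hu.coe_apply_eq_exp hG₁.1.1 hnil x.toAdd
    rw [show Multiplicative.ofAdd x.toAdd = x from rfl] at e
    rw [e]
    refine det_restrMat_coe_expHom W₁ hW₁ ?_ hnil x
    rw [h₁.velocity_rootSL2_lower]; exact (h₁.rootF_mem i).1

omit [Fintype ι] in
include hG₂ hT₁ hT₂ in
/-- **`H₁ ≤ detOneSnd`.** [cite: SpringerLAG1998, 2.4.2 and 9.6.2] -/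
theorem graphUnip_le_detOneSnd (y : Y) (W₂ : Submodule k (n₂ → k))
    (hW₂ : ∀ g ∈ G₂, StableDet.Stab W₂ ((g : GL n₂ k) : Matrix n₂ n₂ k)) :
    graphUnip h₁ h₂ y ≤ detOneSnd (n₁ := n₁) W₂ hW₂ := by
  haveI : Infinite k := IsAlgClosed.instInfinite
  refine iSup_le fun i => sup_le ?_ ?_
  · rintro _ ⟨x, rfl⟩
    rw [graphUpperGL_apply, blockDiagGL_mem_detOneSnd_iff, StableDet.mem_detOneSubgroup_iff]
    refine ⟨((h₂.rootSL2 i).comp unipotentUpperSL2 x).2, ?_⟩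
    have hu := h₂.isRootHom_rootSL2_upper i
    have hnil : IsNilpotent hu.1.velocity := by
      rw [h₂.velocity_rootSL2_upper]; exact isNilpotent_of_fromBlocks₂ (isNilpotent_graphE h₁ h₂ hT₁.2.1 hT₂.2.1 i)
    have e := hu.coe_apply_eq_exp hG₂.1.1 hnil x.toAdd
    rw [show Multiplicative.ofAdd x.toAdd = x from rfl] at e
    rw [e]
    refine det_restrMat_coe_expHom W₂ hW₂ ?_ hnil x
    rw [h₂.velocity_rootSL2_upper]; exact (h₂.rootE_mem i).1
  · rintro _ ⟨x, rfl⟩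
    rw [graphLowerGL_apply, blockDiagGL_mem_detOneSnd_iff, StableDet.mem_detOneSubgroup_iff]
    refine ⟨((h₂.rootSL2 i).comp unipotentLowerSL2 x).2, ?_⟩
    have hu := h₂.isRootHom_rootSL2_lower i
    have hnil : IsNilpotent hu.1.velocity := by
      rw [h₂.velocity_rootSL2_lower]; exact isNilpotent_of_fromBlocks₂ (isNilpotent_graphF h₁ h₂ hT₁.2.1 hT₂.2.1 i)
    have e := hu.coe_apply_eq_exp hG₂.1.1 hnil x.toAdd
    rw [show Multiplicative.ofAdd x.toAdd = x from rfl] at e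
    rw [e]
    refine det_restrMat_coe_expHom W₂ hW₂ ?_ hnil x
    rw [h₂.velocity_rootSL2_lower]; exact (h₂.rootF_mem i).1

omit [CharZero k] [Fintype ι] [IsMulCommutative ↥T₁] [IsMulCommutative ↥T₂] [IsAlgClosed k] in
/-- First blocks of a subgroup of `detOneFst` have `det (·|_{W₁}) = 1`. [folklore] -/
lemma fstOf_le_detOneSubgroup {W₁ : Submodule k (n₁ → k)}
    {hW₁ : ∀ g ∈ G₁, StableDet.Stab W₁ ((g : GL n₁ k) : Matrix n₁ n₁ k)} {S : Subgroup (GL (n₁ ⊕ n₂) k)}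
    (hS : S ≤ detOneFst (n₂ := n₂) W₁ hW₁) (hSb : S ≤ blockDiagRange n₁ n₂ k) :
    fstOf S hSb ≤ StableDet.detOneSubgroup W₁ G₁ hW₁ := by
  rintro _ ⟨x, rfl⟩
  obtain ⟨q, hq, hqe⟩ := hS x.2
  have hq' := Subgroup.mem_comap.1 hq
  have : Subgroup.inclusion hSb x = q := Subtype.ext hqe.symm
  rw [MonoidHom.comp_apply, this]
  exact hq'

omit [CharZero k] [Fintype ι] [IsMulCommutative ↥T₁] [IsMulCommutative ↥T₂] [IsAlgClosed k] in
/-- Second blocks of a subgroup of `detOneSnd` have `det (·|_{W₂}) = 1`. [folklore] -/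
lemma sndOf_le_detOneSubgroup {W₂ : Submodule k (n₂ → k)}
    {hW₂ : ∀ g ∈ G₂, StableDet.Stab W₂ ((g : GL n₂ k) : Matrix n₂ n₂ k)} {S : Subgroup (GL (n₁ ⊕ n₂) k)}
    (hS : S ≤ detOneSnd (n₁ := n₁) W₂ hW₂) (hSb : S ≤ blockDiagRange n₁ n₂ k) :
    sndOf S hSb ≤ StableDet.detOneSubgroup W₂ G₂ hW₂ := by
  rintro _ ⟨x, rfl⟩
  obtain ⟨q, hq, hqe⟩ := hS x.2
  have hq' := Subgroup.mem_comap.1 hq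
  have : Subgroup.inclusion hSb x = q := Subtype.ext hqe.symm
  rw [MonoidHom.comp_apply, this]
  exact hq'

include h₂ in
omit [CharZero k] [Fintype ι] in
/-- `tr (h²_j|_{W₂}) = 0` on `G₂`-stable subspaces (`h = [e, f]`). [folklore] -/
lemma trace_restrMat_rootH_eq_zero (W₂ : Submodule k (n₂ → k))
    (hW₂ : ∀ g ∈ G₂, StableDet.Stab W₂ ((g : GL n₂ k) : Matrix n₂ n₂ k)) (j : ι) :
    (StableDet.restrMat W₂ (h₂.rootH j)).trace = 0 := by
  haveI : Infinite k := IsAlgClosed.instInfinite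
  rw [← h₂.lie_rootE_rootF j]
  exact trace_restrMat_lie_eq_zero W₂
    (fun w hw => mulVec_mem_of_forall_mulVec_mem (fun g hg w hw => hW₂ g hg w hw) (h₂.rootE_mem j).1 hw)
    (fun w hw => mulVec_mem_of_forall_mulVec_mem (fun g hg w hw => hW₂ g hg w hw) (h₂.rootF_mem j).1 hw)

include hG₁ hG₂ in
/-- **The Lie algebra of a subgroup `S` of `T_{H,1}` lies in `Lie(T̃)`.** [cite: SpringerLAG1998, 9.6.2] -/
theorem lieAlgebraGL_le_of_le_torusPart₁ {y : Y} (hy : ∀ i, P.root' i y ≠ 0) {S : Subgroup (GL (n₁ ⊕ n₂) k)}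
    (hS : S ≤ torusPart₁ h₁ h₂ y) :
    lieAlgebraGL S ≤ lieAlgebraGL (graphTorus eX₁ eX₂ hT₁.2.1 hT₂.2.1) := by
  classical
  haveI : Infinite k := IsAlgClosed.instInfinite
  intro Xm hXm
  have hSP : S ≤ torusPart hT₁ hT₂ h₁ h₂ y := hS.trans (torusPart₁_le hT₁ hT₂ h₁ h₂ y)
  have hX := lieAlgebraGL_mono hSP hXm
  have hXT := lieAlgebraGL_mono (inf_le_right : torusPart hT₁ hT₂ h₁ h₂ y ≤ prodBlock T₁ T₂) hX
  obtain ⟨hXeq, hA, hB⟩ := eq_fromBlocks_of_mem_lieAlgebraGL_prodBlock hXT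
  set A := Xm.toBlocks₁₁ with hAdef
  set B := Xm.toBlocks₂₂ with hBdef
  have hSb : S ≤ blockDiagRange n₁ n₂ k := hSP.trans (inf_le_right.trans prodBlock_le_blockDiagRange)
  have hSU : S ≤ graphUnip h₁ h₂ y := hS.trans inf_le_left
  -- trace conditions on both blocks
  have htrA : ∀ W : Submodule k (n₁ → k), (∀ g ∈ G₁, StableDet.Stab W ((g : GL n₁ k) : Matrix n₁ n₁ k)) →
      (StableDet.restrMat W A).trace = 0 := by
    intro W hW
    have hle := fstOf_le_detOneSubgroup ((hSU.trans (graphUnip_le_detOneFst hG₁ hT₁ hT₂ h₁ h₂ y W hW))) hSb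
    exact StableDet.trace_restrMat_eq_zero_of_mem_lieAlgebraGL
      (lieAlgebraGL_mono hle (toBlocks₁₁_mem_lieAlgebraGL_fstOf hSb hXm))
  have htrB : ∀ W : Submodule k (n₂ → k), (∀ g ∈ G₂, StableDet.Stab W ((g : GL n₂ k) : Matrix n₂ n₂ k)) →
      (StableDet.restrMat W B).trace = 0 := by
    intro W hW
    have hle := sndOf_le_detOneSubgroup ((hSU.trans (graphUnip_le_detOneSnd hT₁ hG₂ hT₂ h₁ h₂ y W hW))) hSb
    exact StableDet.trace_restrMat_eq_zero_of_mem_lieAlgebraGL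
      (lieAlgebraGL_mono hle (toBlocks₂₂_mem_lieAlgebraGL_sndOf hSb hXm))
  -- `A` is a combination of the coroot vectors
  have hAspan := mem_span_rootH_of_forall_trace_eq_zero hG₁ hT₁ h₁ hA htrA
  obtain ⟨c, hc⟩ := (Submodule.mem_span_range_iff_exists_fun k).1 hAspan
  -- `θ A = ∑ c_j h²_j`
  have hθ : ((theta eX₁ eX₂ hT₁.2.1 hT₂.2.1 ⟨A, hA⟩ : ↥(lieAlgebraGL T₂)) : Matrix n₂ n₂ k) = ∑ j, c j • h₂.rootH j := by
    have hsub : (⟨A, hA⟩ : ↥(lieAlgebraGL T₁)) = ∑ j, c j • (⟨h₁.rootH j, h₁.rootH_mem_lieAlgebraGL j⟩ : ↥(lieAlgebraGL T₁)) := by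
      apply Subtype.ext
      rw [Submodule.coe_sum]
      simp only [Submodule.coe_smul]
      exact hc.symm
    rw [hsub, map_sum, Submodule.coe_sum]
    refine Finset.sum_congr rfl fun j _ => ?_
    rw [map_smul, Submodule.coe_smul, theta_rootH h₁ h₂]
  -- `B = θ A`
  have hζ := sub_theta_mem_torusCenter hG₁ hT₁ hG₂ hT₂ h₁ h₂ hy hX hA hB
  have hζ0 : B - ((theta eX₁ eX₂ hT₁.2.1 hT₂.2.1 ⟨A, hA⟩ : ↥(lieAlgebraGL T₂)) : Matrix n₂ n₂ k) = 0 := by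
    refine eq_zero_of_mem_torusCenter_of_forall_trace hG₂ hT₂ h₂ hζ fun W hW => ?_
    rw [hθ, sub_eq_add_neg, StableDet.restrMat_add, Matrix.trace_add, htrB W hW, zero_add,
      ← neg_one_smul k, StableDet.restrMat_smul, Matrix.trace_smul, StableDet.restrMat_sum, Matrix.trace_sum,
      Finset.sum_eq_zero fun j _ => ?_, smul_zero]
    rw [StableDet.restrMat_smul, Matrix.trace_smul, trace_restrMat_rootH_eq_zero h₂ W hW j, smul_zero]
  rw [sub_eq_zero, hθ] at hζ0
  -- assemble: `X = ∑ c_j h̃_j ∈ Lie(T̃)`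
  have hXsum : Xm = ∑ j, c j • graphHc h₁ h₂ j := by
    rw [hXeq, ← hc, hζ0]
    have e : ∀ j, c j • graphHc h₁ h₂ j =
        blockDiagLin (c j • ((h₁.rootH j, h₂.rootH j) : Matrix n₁ n₁ k × Matrix n₂ n₂ k)) := by
      intro j; rw [map_smul]; rfl
    simp_rw [e]
    rw [← map_sum, blockDiagLin_apply]
    congr 1
    · rw [Prod.fst_sum]; simp only [Prod.smul_fst]
    · rw [Prod.snd_sum]; simp only [Prod.smul_snd]
  rw [hXsum]
  exact Submodule.sum_mem _ fun j _ => Submodule.smul_mem _ _ (graphHc_mem_lieAlgebraGL_graphTorus h₁ h₂ hT₁.2.1 hT₂.2.1 j)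

include hG₁ hG₂ in
/-- **`(T_{H,1})° ≤ T̃`.** [cite: SpringerLAG1998, 9.6.2] -/
theorem identityComponent_torusPart₁_le {y : Y} (hy : ∀ i, P.root' i y ≠ 0) :
    identityComponent (torusPart₁ h₁ h₂ y) ≤ graphTorus eX₁ eX₂ hT₁.2.1 hT₂.2.1 := by
  have hD := isTorusSubgroup_prodBlock hT₁.2.1 hT₂.2.1
  have h1alg := isAlgebraicSubgroup_torusPart₁ hT₁ hT₂ h₁ h₂ y
  have hS : IsTorusSubgroup (identityComponent (torusPart₁ h₁ h₂ y)) :=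
    isTorusSubgroup_identityComponent hD h1alg inf_le_right
  refine le_of_lieAlgebraGL_le hD.2.1 hD.2.2 ((identityComponent_le _).trans inf_le_right)
    (graphTorus_le_prodBlock eX₁ eX₂ hT₁.2.1 hT₂.2.1) hS (isTorusSubgroup_graphTorus eX₁ eX₂ hT₁.2.1 hT₂.2.1).1.1 ?_
  exact lieAlgebraGL_le_of_le_torusPart₁ hG₁ hT₁ hG₂ hT₂ h₁ h₂ hy (identityComponent_le _)

end TorusLie

/-! ### `T̃` is a maximal torus of `H` -/

section Maximal

variable [IsAlgClosed k] [CharZero k] [Fintype ι]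
variable (hG₁ : IsConnectedReductive G₁) (hT₁ : IsMaximalTorusIn T₁ G₁)
  (hG₂ : IsConnectedReductive G₂) (hT₂ : IsMaximalTorusIn T₂ G₂)
  (h₁ : IsRootDatumOf G₁ T₁ P eX₁ eY₁) (h₂ : IsRootDatumOf G₂ T₂ P eX₂ eY₂)

omit [CharZero k] [Fintype ι] in
/-- `T_H` is commutative. [folklore] -/
lemma isMulCommutative_torusPart (y : Y) : IsMulCommutative ↥(torusPart hT₁ hT₂ h₁ h₂ y) :=
  ⟨⟨fun a b => by
    have e : (a : GL (n₁ ⊕ n₂) k) * b = b * a := congrArg Subtype.val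
      ((isTorusSubgroup_prodBlock hT₁.2.1 hT₂.2.1).2.1.is_comm.comm ⟨a.1, a.2.2⟩ ⟨b.1, b.2.2⟩)
    exact Subtype.ext e⟩⟩

include hG₁ hG₂ in
/-- **`T̃` has finite index in `T_H`.** [cite: SpringerLAG1998, 9.6.2 and 2.2.1] -/
theorem relIndex_graphTorus_torusPart_ne_zero {y : Y} (hy : ∀ i, P.root' i y ≠ 0) :
    (graphTorus eX₁ eX₂ hT₁.2.1 hT₂.2.1).relIndex (torusPart hT₁ hT₂ h₁ h₂ y) ≠ 0 := by
  set Tt := graphTorus eX₁ eX₂ hT₁.2.1 hT₂.2.1 with hTt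
  set TP := torusPart hT₁ hT₂ h₁ h₂ y with hTP
  set TP₁ := torusPart₁ h₁ h₂ y with hTP₁
  -- `T̃` has finite index in `T_{H,1}`
  have h1 : Tt.relIndex TP₁ ≠ 0 := by
    intro h0
    haveI := finiteIndex_identityComponent (isAlgebraicSubgroup_torusPart₁ hT₁ hT₂ h₁ h₂ y)
    have hfi : (identityComponent TP₁).relIndex TP₁ ≠ 0 := Subgroup.FiniteIndex.index_ne_zero
    exact hfi (Subgroup.relIndex_eq_zero_of_le_left
      (identityComponent_torusPart₁_le hG₁ hT₁ hG₂ hT₂ h₁ h₂ hy) h0)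
  -- pass to the commutative group `T_H`
  haveI := isMulCommutative_torusPart hT₁ hT₂ h₁ h₂ y
  have hTtP : Tt ≤ TP := graphTorus_le_torusPart hT₁ hT₂ h₁ h₂ y
  have h1P : TP₁ ≤ TP := torusPart₁_le hT₁ hT₂ h₁ h₂ y
  haveI hN : (Tt.subgroupOf TP).Normal := ⟨fun a ha g => by
    have hc : g * a = a * g := IsMulCommutative.is_comm.comm g a
    rwa [hc, mul_inv_cancel_right]⟩
  have hsup : Tt.subgroupOf TP ⊔ TP₁.subgroupOf TP = ⊤ := by
    rw [← Subgroup.subgroupOf_sup hTtP h1P]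
    have hle : TP.subgroupOf TP ≤ (Tt ⊔ TP₁).subgroupOf TP := Subgroup.comap_mono (torusPart_le_sup hT₁ hT₂ h₁ h₂ y)
    rw [Subgroup.subgroupOf_self] at hle
    exact top_le_iff.1 hle
  have key := Subgroup.relIndex_sup_left (K := Tt.subgroupOf TP) (H := TP₁.subgroupOf TP)
  rw [hsup, Subgroup.relIndex_top_right, Subgroup.relIndex_subgroupOf h1P] at key
  change (Tt.subgroupOf TP).index ≠ 0
  rw [key]
  exact h1

omit [CharZero k] [Fintype ι] in
include hG₁ hG₂ in
/-- **A torus of `H` containing `T̃` lies in `T_H`** (its blocks centralise `T₁`, `T₂`; Springer 7.6.4 (ii)).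
[cite: SpringerLAG1998, 7.6.4] -/
theorem le_torusPart_of_torus {y : Y} {S : Subgroup (GL (n₁ ⊕ n₂) k)} (hS : IsTorusSubgroup S)
    (h1 : graphTorus eX₁ eX₂ hT₁.2.1 hT₂.2.1 ≤ S) (h2 : S ≤ graphGroup h₁ h₂ hT₁.2.1 hT₂.2.1 (simpleRoots P y)) :
    S ≤ torusPart hT₁ hT₂ h₁ h₂ y := by
  refine le_inf h2 fun s hs => ?_
  have hsG := graphGroup_le_prodBlock h₁ h₂ hT₁.2.1 hT₂.2.1 _ (h2 hs)
  obtain ⟨a, ha, b, hb, rfl⟩ := mem_prodBlock_iff.1 hsG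
  have hcomm : ∀ t : ↥T₁, blockDiagGL (a, b) * graphTorusHom eX₁ eX₂ hT₁.2.1 hT₂.2.1 t =
      graphTorusHom eX₁ eX₂ hT₁.2.1 hT₂.2.1 t * blockDiagGL (a, b) := fun t =>
    congrArg Subtype.val (hS.2.1.is_comm.comm ⟨_, hs⟩ ⟨_, h1 ⟨t, rfl⟩⟩)
  have hc : ∀ t : ↥T₁, a * (t : GL n₁ k) = t * a ∧
      b * ((torusIsoOfWeights eX₁ eX₂ hT₁.2.1 hT₂.2.1 t : ↥T₂) : GL n₂ k) =
        (torusIsoOfWeights eX₁ eX₂ hT₁.2.1 hT₂.2.1 t : ↥T₂) * b := by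
    intro t
    have e := hcomm t
    rw [graphTorusHom_apply, ← map_mul, ← map_mul, Prod.mk_mul_mk, Prod.mk_mul_mk] at e
    exact Prod.ext_iff.1 (blockDiagGL_injective e)
  have haT : a ∈ T₁ := by
    rw [← centralizer_eq_of_isMaximalTorusIn_holds hG₁ hT₁]
    exact ⟨ha, Subgroup.mem_centralizer_iff.2 fun t ht => ((hc ⟨t, ht⟩).1).symm⟩
  have hbT : b ∈ T₂ := by
    rw [← centralizer_eq_of_isMaximalTorusIn_holds hG₂ hT₂]
    refine ⟨hb, Subgroup.mem_centralizer_iff.2 fun t ht => ?_⟩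
    obtain ⟨t₁, ht₁⟩ := (torusIsoOfWeights eX₁ eX₂ hT₁.2.1 hT₂.2.1).surjective ⟨t, ht⟩
    have e := (hc t₁).2
    rw [ht₁] at e
    exact e.symm
  exact blockDiagGL_mem_prodBlock haT hbT

include hG₁ hG₂ in
/-- **A torus of `H` containing `T̃` equals `T̃`.** [cite: SpringerLAG1998, 9.6.2] -/
theorem eq_graphTorus_of_torus {y : Y} (hy : ∀ i, P.root' i y ≠ 0) {S : Subgroup (GL (n₁ ⊕ n₂) k)}
    (hS : IsTorusSubgroup S) (h1 : graphTorus eX₁ eX₂ hT₁.2.1 hT₂.2.1 ≤ S)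
    (h2 : S ≤ graphGroup h₁ h₂ hT₁.2.1 hT₂.2.1 (simpleRoots P y)) :
    S = graphTorus eX₁ eX₂ hT₁.2.1 hT₂.2.1 := by
  have hSP := le_torusPart_of_torus hG₁ hT₁ hG₂ hT₂ h₁ h₂ hS h1 h2
  have hfi : (graphTorus eX₁ eX₂ hT₁.2.1 hT₂.2.1).relIndex S ≠ 0 := fun h0 =>
    relIndex_graphTorus_torusPart_ne_zero hG₁ hT₁ hG₂ hT₂ h₁ h₂ hy (Subgroup.relIndex_eq_zero_of_le_right hSP h0)
  exact (hS.1.2 _ h1 (isTorusSubgroup_graphTorus eX₁ eX₂ hT₁.2.1 hT₂.2.1).1.1 ⟨hfi⟩).symm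

include hG₁ hG₂ in
/-- **The graph torus `T̃` is a maximal torus of the graph group `H`.** [cite: SpringerLAG1998, 9.6.2] -/
theorem isMaximalTorusIn_graphTorus {y : Y} (hy : ∀ i, P.root' i y ≠ 0) :
    IsMaximalTorusIn (graphTorus eX₁ eX₂ hT₁.2.1 hT₂.2.1) (graphGroup h₁ h₂ hT₁.2.1 hT₂.2.1 (simpleRoots P y)) :=
  ⟨graphTorus_le_graphGroup h₁ h₂ hT₁.2.1 hT₂.2.1 _, isTorusSubgroup_graphTorus eX₁ eX₂ hT₁.2.1 hT₂.2.1,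
    fun _ h1 h2 hS => eq_graphTorus_of_torus hG₁ hT₁ hG₂ hT₂ h₁ h₂ hy hS h1 h2⟩

end Maximal

end LieGraph

end Literature.NumberTheory.Automorphic
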